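import Summits.QuantumFields.YangMills.Theorems.PencilRigidityWeakCouplingHypercubicLimitStubRpSpectralOfColdPressure
import HarnessLib

/-!
# Cold pressure ⇒ the RP-spectral clause of `GapData` at fixed coupling (line `Sketch` of crux
# `PencilRigidity.WeakCouplingHypercubicLimit`, stmt-QuantumFields-16120)

`gapDataRP_of_coldPressure`: at a fixed coupling `β ≥ 0`, a cold-pressure bound with rate `g > 0` on the cold tori
`S ≥ S₁` yields, for every rate `0 ≤ g' ≤ g`, a thermal error `ε : ℕ → ℝ` with `ε S → 0` such that for ALL tori `S`,
slab widths `T`, separations `n` with `2(T+n+1) ≤ S` and all bounded measurable slab functionals `Y` (sup `B`),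
`|⟨ΘY · Y_n⟩ − ⟨Y⟩²| ≤ e^{−g' n} (⟨ΘY · Y⟩ − ⟨Y⟩²) + ε S · B²` — verbatim the body of the fourth conjunct of
`GapData G r β₁ C₁ c₂ m` (`PencilRigidityHypercubicLimitDefs`, the imported IR input of the host closures of
stmt-8646 / stmt-16154) at the coupling `β` with `m β = g'`.  On `S ≥ S₁` this is `stub_rpSpectralOfColdPressure` with
`ε S = 16 C₀ (2S+1)³ e^{−3gS/4}`; below `S₁` the a priori sizes suffice with `ε S = 4`. [folklore]
-/

noncomputable section

open scoped BigOperators Topology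
open MeasureTheory Filter
open Literature.MathematicalPhysics.QuantumFieldTheory Literature.MathematicalPhysics.QuantumLattice

namespace Summit.QuantumFields.YangMills.Theorems.WeakCouplingHypercubicLimit.TraceNormColdPressure

/-- **Cold pressure ⇒ the RP-spectral clause of `GapData` at fixed coupling** (with a thermal error `ε S → 0`); see the
module docstring. [folklore] -/
theorem gapDataRP_of_coldPressure :
    ∀ (G : Type) [Group G] [TopologicalSpace G] [IsTopologicalGroup G] [CompactSpace G]
      [MeasurableSpace G] [BorelSpace G] (r : LatticeRep G) (β : ℝ), 0 ≤ β →
    ∀ (g C₀ : ℝ) (S₁ : ℕ), 0 < g → 0 ≤ C₀ →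
      (∀ S : ℕ, S₁ ≤ S → ∀ m : ℕ, S + 1 ≤ 2 * (m + 2) →
        traceExcess r.ρ β (2 * S + 1) (m + 2) ≤ C₀ * ((2 * S + 1 : ℕ) : ℝ) ^ 3 * Real.exp (-(g * ((m + 2 : ℕ) : ℝ)))) →
    ∀ g' : ℝ, 0 ≤ g' → g' ≤ g →
      ∃ ε : ℕ → ℝ, Tendsto ε atTop (𝓝 0) ∧
        ∀ (S T n : ℕ), 2 * (T + n + 1) ≤ S →
          ∀ (Y : LGConfig 4 G → ℝ) (B : ℝ), Measurable Y → (∀ U, |Y U| ≤ B) →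
            DependsOn Y {e : Literature.MathematicalPhysics.QuantumLattice.ZdEdge 4 |
                1 ≤ e.1 0 ∧ e.1 0 + (if e.2 = 0 then 1 else 0) ≤ T} →
              |(∫ U, Y (torusLift (2 * S + 1) (GaugeConfig.timeReflect U)) *
                    Y (configShift (-Pi.single 0 (n : ℤ)) (torusLift (2 * S + 1) U))
                  ∂(wilsonMeasure r.ρ β : Measure (GaugeConfig 4 (2 * S + 1) G))) -
                  (∫ U, Y (torusLift (2 * S + 1) U) ∂(wilsonMeasure r.ρ β : Measure (GaugeConfig 4 (2 * S + 1) G))) ^ 2|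
                ≤ Real.exp (-(g' * n)) *
                    ((∫ U, Y (torusLift (2 * S + 1) (GaugeConfig.timeReflect U)) *
                        Y (torusLift (2 * S + 1) U) ∂(wilsonMeasure r.ρ β : Measure (GaugeConfig 4 (2 * S + 1) G))) -
                      (∫ U, Y (torusLift (2 * S + 1) U) ∂(wilsonMeasure r.ρ β : Measure (GaugeConfig 4 (2 * S + 1) G))) ^ 2) +
                  ε S * B ^ 2 := by
  intro G _ _ _ _ _ _ r β hβ g C₀ S₁ hg hC₀ hP g' hg'0 hg'g
  classical
  refine ⟨fun S => if S₁ ≤ S then 16 * C₀ * ((2 * S + 1 : ℕ) : ℝ) ^ 3 * Real.exp (-(g * (3 * (S : ℝ) / 4))) else 4, ?_, ?_⟩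
  · -- `ε S → 0`: eventually `ε S = 16 C₀ (2S+1)³ e^{-(3g/4) S}` and `u³ e^{-u} → 0`
    have hc : 0 < 3 * g / 4 := by positivity
    have hu : Tendsto (fun S : ℕ => 3 * g / 4 * (S : ℝ)) atTop atTop :=
      (tendsto_natCast_atTop_atTop.atTop_mul_const hc).congr fun S => by ring
    have h3 := (Real.tendsto_pow_mul_exp_neg_atTop_nhds_zero 3).comp hu
    have h4 : Tendsto (fun S : ℕ => 16 * C₀ * 27 * (4 / (3 * g)) ^ 3 * ((3 * g / 4 * (S : ℝ)) ^ 3 * Real.exp (-(3 * g / 4 * S))))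
        atTop (𝓝 (16 * C₀ * 27 * (4 / (3 * g)) ^ 3 * 0)) := h3.const_mul _
    rw [mul_zero] at h4
    -- domination `0 ≤ ε S ≤ 16 C₀ 27 (4/3g)³ u³ e^{-u}` for `S ≥ max S₁ 1`
    refine tendsto_of_tendsto_of_tendsto_of_le_of_le' tendsto_const_nhds h4 ?_ ?_
    · filter_upwards [eventually_ge_atTop S₁] with S hS
      rw [if_pos hS]; positivity
    · filter_upwards [eventually_ge_atTop S₁, eventually_ge_atTop 1] with S hS hS1
      rw [if_pos hS]
      have hS1R : (1 : ℝ) ≤ S := by exact_mod_cast hS1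
      have hcube : ((2 * S + 1 : ℕ) : ℝ) ^ 3 ≤ 27 * (4 / (3 * g)) ^ 3 * (3 * g / 4 * (S : ℝ)) ^ 3 := by
        have hid : 27 * (4 / (3 * g)) ^ 3 * (3 * g / 4 * (S : ℝ)) ^ 3 = (3 * (S : ℝ)) ^ 3 := by
          field_simp
          ring
        rw [hid]
        have hle : ((2 * S + 1 : ℕ) : ℝ) ≤ 3 * (S : ℝ) := by push_cast; linarith
        exact pow_le_pow_left₀ (by positivity) hle 3
      have hexpeq : Real.exp (-(g * (3 * (S : ℝ) / 4))) = Real.exp (-(3 * g / 4 * S)) := by ring_nf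
      rw [hexpeq]
      calc 16 * C₀ * ((2 * S + 1 : ℕ) : ℝ) ^ 3 * Real.exp (-(3 * g / 4 * S))
          ≤ 16 * C₀ * (27 * (4 / (3 * g)) ^ 3 * (3 * g / 4 * (S : ℝ)) ^ 3) * Real.exp (-(3 * g / 4 * S)) := by
            gcongr
        _ = 16 * C₀ * 27 * (4 / (3 * g)) ^ 3 * ((3 * g / 4 * (S : ℝ)) ^ 3 * Real.exp (-(3 * g / 4 * S))) := by ring
  · intro S T n hgeom Y B hYm hYb hYd
    by_cases hS : S₁ ≤ S
    · dsimp only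
      rw [if_pos hS]
      have h := stub_rpSpectralOfColdPressure G r β hβ g C₀ S₁ hg.le hC₀ hP S T n hS hgeom Y B hYm hYb hYd g' hg'0 hg'g
      refine h.trans (le_of_eq ?_)
      ring
    · dsimp only
      rw [if_neg hS]
      -- a priori sizes: `|⟨ΘY · Y_n⟩ − ⟨Y⟩²| ≤ 2B²`, `e^{−g'n}(⟨ΘY · Y⟩ − ⟨Y⟩²) ≥ −2B²`
      haveI : SecondCountableTopology G :=
        (r.continuous.isClosedEmbedding r.injective).isEmbedding.secondCountableTopology
      haveI := isProbabilityMeasure_wilsonMeasure (d := 4) (L := 2 * S + 1) r.ρ r.continuous β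
      have hB0 : 0 ≤ B := (abs_nonneg _).trans (hYb fun _ => 1)
      have hI1 : |∫ U, Y (torusLift (2 * S + 1) U) ∂(wilsonMeasure r.ρ β : Measure (GaugeConfig 4 (2 * S + 1) G))| ≤ B := by
        have h := norm_integral_le_of_norm_le_const (μ := (wilsonMeasure r.ρ β : Measure (GaugeConfig 4 (2 * S + 1) G)))
          (f := fun U => Y (torusLift (2 * S + 1) U)) (C := B) (Eventually.of_forall fun U => by
            rw [Real.norm_eq_abs]; exact hYb _)
        simpa [Real.norm_eq_abs] using h
      have hI2 : ∀ F : GaugeConfig 4 (2 * S + 1) G → LGConfig 4 G,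
          |∫ U, Y (torusLift (2 * S + 1) (GaugeConfig.timeReflect U)) * Y (F U)
            ∂(wilsonMeasure r.ρ β : Measure (GaugeConfig 4 (2 * S + 1) G))| ≤ B ^ 2 := by
        intro F
        have h := norm_integral_le_of_norm_le_const (μ := (wilsonMeasure r.ρ β : Measure (GaugeConfig 4 (2 * S + 1) G)))
          (f := fun U => Y (torusLift (2 * S + 1) (GaugeConfig.timeReflect U)) * Y (F U)) (C := B ^ 2)
          (Eventually.of_forall fun U => by
            rw [Real.norm_eq_abs, abs_mul, pow_two]
            exact mul_le_mul (hYb _) (hYb _) (abs_nonneg _) hB0)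
        simpa [Real.norm_eq_abs] using h
      have hsq : (∫ U, Y (torusLift (2 * S + 1) U) ∂(wilsonMeasure r.ρ β : Measure (GaugeConfig 4 (2 * S + 1) G))) ^ 2 ≤ B ^ 2 := by
        have h := hI1
        rw [abs_le] at h
        nlinarith [h.1, h.2]
      have hsq0 : 0 ≤ (∫ U, Y (torusLift (2 * S + 1) U) ∂(wilsonMeasure r.ρ β : Measure (GaugeConfig 4 (2 * S + 1) G))) ^ 2 :=
        sq_nonneg _
      have hCovn := hI2 fun U => configShift (-Pi.single 0 (n : ℤ)) (torusLift (2 * S + 1) U)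
      have hCov0 := hI2 fun U => torusLift (2 * S + 1) U
      rw [abs_le] at hCovn hCov0
      have hexp1 : Real.exp (-(g' * n)) ≤ 1 := Real.exp_le_one_iff.mpr (by nlinarith [Nat.cast_nonneg (α := ℝ) n])
      have hexp0 : 0 ≤ Real.exp (-(g' * n)) := (Real.exp_pos _).le
      have hanchor : -(2 * B ^ 2) ≤ Real.exp (-(g' * n)) *
          ((∫ U, Y (torusLift (2 * S + 1) (GaugeConfig.timeReflect U)) * Y (torusLift (2 * S + 1) U)
              ∂(wilsonMeasure r.ρ β : Measure (GaugeConfig 4 (2 * S + 1) G))) -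
            (∫ U, Y (torusLift (2 * S + 1) U) ∂(wilsonMeasure r.ρ β : Measure (GaugeConfig 4 (2 * S + 1) G))) ^ 2) := by
        set c := (∫ U, Y (torusLift (2 * S + 1) (GaugeConfig.timeReflect U)) * Y (torusLift (2 * S + 1) U)
              ∂(wilsonMeasure r.ρ β : Measure (GaugeConfig 4 (2 * S + 1) G))) -
            (∫ U, Y (torusLift (2 * S + 1) U) ∂(wilsonMeasure r.ρ β : Measure (GaugeConfig 4 (2 * S + 1) G))) ^ 2 with hc
        have hc2 : -(2 * B ^ 2) ≤ c := by rw [hc]; linarith [hCov0.1]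
        by_cases hc0 : 0 ≤ c
        · nlinarith [mul_nonneg hexp0 hc0, sq_nonneg B]
        · push Not at hc0
          nlinarith [mul_le_mul_of_nonpos_right hexp1 hc0.le]
      rw [abs_le]
      constructor <;> nlinarith [hCovn.1, hCovn.2, hsq, hsq0, hanchor, sq_nonneg B]

end Summit.QuantumFields.YangMills.Theorems.WeakCouplingHypercubicLimit.TraceNormColdPressure

end
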